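import Mathlib
import Literature.Analysis.FluidPDE.GaussianVortexPlanar
import Literature.Analysis.FluidPDE.GaussianVortexPlanarProofs
import Literature.Analysis.FluidPDE.BiotSavart2DSymmetry
import Literature.Analysis.UnboundedOperators.WeightedGreenIdentity
import HarnessLib

/-!
# Tools for the helper `coreL_angular_pairing_eq_zero` toward stub `stub_coreInverse` of the line
# `braid-closed-large-circulation-gluing` (crux stmt-AnomalousDissipation-3009, `MarginalStabilityChain.StretchedVortexRows`)

Pointwise calculus behind (I9) `⟨L w, ∂_θ w⟩_{L²(G⁻¹)} = 0` (`G = gaussVortexProfile = (4π)⁻¹e^{−|ξ|²/4}`, `w = G u`,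
`L(Gu) = G·Au` with the Ornstein–Uhlenbeck operator `Au = Δu − ½ ξ·∇u`, `∂_θu = Du[ξ^⊥]` the angular derivative), for
`u ∈ C²(ℝ²)` — no third derivatives are ever taken:

* **divergence form** `G·Au = ∂₀(G∂₀u) + ∂₁(G∂₁u)` (`∇G = −(ξ/2)G`): the registered helper `coreL_gauss_divergence_form`
  (= `gauss_mul_ornsteinUhlenbeck_eq_sum_fderiv_gaussFlux`);
* the derivative of the angular derivative, `D(∂_θu)(ξ)[w] = Du(ξ)[w^⊥] + D²u(ξ)[w][ξ^⊥]` (`fderiv_angularDeriv_apply`), and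
  the key identity **`G ∇u·∇(∂_θu) = ½ ∂_θ(G|∇u|²)`** (`fderiv_angularDeriv_mul_gaussFlux_sum_eq`): the commutator
  `[∇, ∂_θ]u = (∂₁u, −∂₀u)` is orthogonal to `∇u`, `D²u` is symmetric, and `∂_θG = 0`;
* the elementary bounds `|∂_θu| ≤ M|ξ|`, `|∂ᵢ∂_θu| ≤ M(1+|ξ|)`, `|∂ᵢ(G∂ᵢu)| ≤ M(1+|ξ|)G` when `u, Du, D²u` are bounded by
  `M`, which (with the Gaussian moments `∫ (1+|ξ|)^N G < ∞` of `…StubCoreRotationLocalSkew`) make every integration by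
  parts in `…StubCoreLAngularPairing` boundary-free.

References: Th. Gallay, C. E. Wayne, Comm. Math. Phys. 255 (2005) §4; D. Bakry, I. Gentil, M. Ledoux, *Analysis and Geometry
of Markov Diffusion Operators*, Springer 2014, §2.7.1 (the Ornstein–Uhlenbeck operator in divergence form).
-/

set_option linter.dupNamespace false

noncomputable section

open scoped RealInnerProductSpace Topology Laplacian
open MeasureTheory WithLp Function Filter

namespace Summit.AnomalousDissipation.AnomalousDissipation.Theorems.MarginalStabilityChainStretchedVortexRows

open Literature.Analysis.FluidPDE Literature.Analysis.UnboundedOperators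

/-! ### Calculus of the angular derivative `∂_θu = Du[ξ^⊥]` of a `C²` function -/

/-- `e₀^⊥ = e₁`. [folklore] -/
private theorem perp_single_zero :
    perp (EuclideanSpace.single (0 : Fin 2) (1 : ℝ)) = EuclideanSpace.single (1 : Fin 2) (1 : ℝ) := by
  ext i; fin_cases i <;> simp [perp]

/-- `e₁^⊥ = −e₀`. [folklore] -/
private theorem perp_single_one :
    perp (EuclideanSpace.single (1 : Fin 2) (1 : ℝ)) = -EuclideanSpace.single (0 : Fin 2) (1 : ℝ) := by
  ext i; fin_cases i <;> simp [perp]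

/-- A coordinate is bounded by the norm: `|ξᵢ| ≤ |ξ|`. [folklore] -/
theorem abs_coord_le_norm_fin_two (ξ : EuclideanSpace ℝ (Fin 2)) (i : Fin 2) : |ξ i| ≤ ‖ξ‖ := by
  simpa [Real.norm_eq_abs] using PiLp.norm_apply_le ξ i

section AngularCalculus

variable {u : EuclideanSpace ℝ (Fin 2) → ℝ} (hu : ContDiff ℝ 2 u)
include hu

/-- `∂_θ u = Du[ξ^⊥]` is `C¹` for `u ∈ C²` (`ξ ↦ ξ^⊥` is linear). [folklore] -/
theorem contDiff_one_angularDeriv : ContDiff ℝ 1 fun y => fderiv ℝ u y (perp y) := by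
  let L : EuclideanSpace ℝ (Fin 2) →L[ℝ] EuclideanSpace ℝ (Fin 2) :=
    LinearMap.toContinuousLinearMap ⟨⟨perp, perp_add⟩, perp_smul⟩
  change ContDiff ℝ 1 fun y => fderiv ℝ u y (L y)
  exact (hu.fderiv_right (m := 1) le_rfl).clm_apply L.contDiff

/-- The derivative of the angular derivative: `D(∂_θu)(ξ)[w] = Du(ξ)[w^⊥] + D²u(ξ)[w][ξ^⊥]`. [folklore] -/
theorem fderiv_angularDeriv_apply (ξ w : EuclideanSpace ℝ (Fin 2)) :
    fderiv ℝ (fun y => fderiv ℝ u y (perp y)) ξ w =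
      fderiv ℝ u ξ (perp w) + fderiv ℝ (fderiv ℝ u) ξ w (perp ξ) := by
  let L : EuclideanSpace ℝ (Fin 2) →L[ℝ] EuclideanSpace ℝ (Fin 2) :=
    LinearMap.toContinuousLinearMap ⟨⟨perp, perp_add⟩, perp_smul⟩
  have hd : DifferentiableAt ℝ (fderiv ℝ u) ξ :=
    ((hu.fderiv_right (m := 1) le_rfl).differentiable one_ne_zero).differentiableAt
  have h := fderiv_clm_apply hd (L.differentiableAt (x := ξ))
  rw [L.fderiv] at h
  change fderiv ℝ (fun y => fderiv ℝ u y (L y)) ξ w = fderiv ℝ u ξ (L w) + fderiv ℝ (fderiv ℝ u) ξ w (L ξ)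
  rw [h]
  rfl

/-- `D(∂ₑu)(ξ)[w] = D²u(ξ)[w][e]`. [folklore] -/
theorem fderiv_partialDeriv_apply (ξ w e : EuclideanSpace ℝ (Fin 2)) :
    fderiv ℝ (fun y => fderiv ℝ u y e) ξ w = fderiv ℝ (fderiv ℝ u) ξ w e := by
  have hd : DifferentiableAt ℝ (fderiv ℝ u) ξ :=
    ((hu.fderiv_right (m := 1) le_rfl).differentiable one_ne_zero).differentiableAt
  rw [fderiv_clm_apply hd (differentiableAt_const e)]
  simp

/-- Symmetry of `D²u` for `u ∈ C²`. [folklore] -/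
theorem fderiv_fderiv_symm_of_contDiff_two (ξ v w : EuclideanSpace ℝ (Fin 2)) :
    fderiv ℝ (fderiv ℝ u) ξ v w = fderiv ℝ (fderiv ℝ u) ξ w v :=
  (hu.contDiffAt.isSymmSndFDerivAt (by simp)) v w

/-- `∂ᵢu` is `C¹`. [folklore] -/
theorem contDiff_one_partialDeriv (e : EuclideanSpace ℝ (Fin 2)) : ContDiff ℝ 1 fun y => fderiv ℝ u y e :=
  (hu.fderiv_right (m := 1) le_rfl).clm_apply contDiff_const

/-- `∂ᵢ(G ∂ᵢu)(ξ) = −(G(ξ)/2) ξᵢ ∂ᵢu(ξ) + G(ξ) ∂ᵢ∂ᵢu(ξ)` (`∂ᵢG = −(ξᵢ/2) G`). [folklore] -/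
theorem fderiv_gaussFlux_apply (i : Fin 2) (ξ : EuclideanSpace ℝ (Fin 2)) :
    fderiv ℝ (fun y => gaussVortexProfile y * fderiv ℝ u y (EuclideanSpace.single i 1)) ξ
        (EuclideanSpace.single i 1) =
      -(gaussVortexProfile ξ / 2) * ξ i * fderiv ℝ u ξ (EuclideanSpace.single i 1) +
        gaussVortexProfile ξ *
          fderiv ℝ (fderiv ℝ u) ξ (EuclideanSpace.single i 1) (EuclideanSpace.single i 1) := by
  have hGd : HasFDerivAt gaussVortexProfile (fderiv ℝ gaussVortexProfile ξ) ξ :=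
    ((contDiff_gaussVortexProfile (n := 1)).differentiable one_ne_zero ξ).hasFDerivAt
  have hdi : HasFDerivAt (fun y => fderiv ℝ u y (EuclideanSpace.single i 1))
      (fderiv ℝ (fun y => fderiv ℝ u y (EuclideanSpace.single i 1)) ξ) ξ :=
    ((contDiff_one_partialDeriv hu _).differentiable one_ne_zero ξ).hasFDerivAt
  rw [(hGd.fun_mul hdi).fderiv]
  simp only [add_apply, FunLike.coe_smul, Pi.smul_apply, smul_eq_mul,
    fderiv_gaussVortexProfile_apply, EuclideanSpace.inner_single_right, fderiv_partialDeriv_apply hu]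
  simp
  ring

/-- **Divergence form of the ground-state conjugated operator**: `G (Δu − ½ ξ·∇u) = ∂₀(G ∂₀u) + ∂₁(G ∂₁u)`,
i.e. `A = G⁻¹∇·(G∇·)` with `∇G = −(ξ/2) G`. [folklore] -/
theorem gauss_mul_ornsteinUhlenbeck_eq_sum_fderiv_gaussFlux (ξ : EuclideanSpace ℝ (Fin 2)) :
    gaussVortexProfile ξ * (Δ u ξ - (1 / 2 * ξ 0 * fderiv ℝ u ξ (EuclideanSpace.single 0 1) +
        1 / 2 * ξ 1 * fderiv ℝ u ξ (EuclideanSpace.single 1 1))) =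
      fderiv ℝ (fun y => gaussVortexProfile y * fderiv ℝ u y (EuclideanSpace.single 0 1)) ξ
          (EuclideanSpace.single 0 1) +
        fderiv ℝ (fun y => gaussVortexProfile y * fderiv ℝ u y (EuclideanSpace.single 1 1)) ξ
          (EuclideanSpace.single 1 1) := by
  rw [fderiv_gaussFlux_apply hu 0 ξ, fderiv_gaussFlux_apply hu 1 ξ,
    laplacian_eq_sum_fderiv_fderiv_apply (EuclideanSpace.basisFun (Fin 2) ℝ) hu ξ]
  simp only [Fin.sum_univ_two, EuclideanSpace.basisFun_apply, fderiv_partialDeriv_apply hu]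
  ring

/-- The derivative of the weighted energy density `h = G ((∂₀u)² + (∂₁u)²)`:
`Dh(ξ)[w] = DG(ξ)[w] ((∂₀u)² + (∂₁u)²) + G (2 ∂₀u D²u(ξ)[w][e₀] + 2 ∂₁u D²u(ξ)[w][e₁])`. [folklore] -/
theorem fderiv_gaussEnergy_apply (ξ w : EuclideanSpace ℝ (Fin 2)) :
    fderiv ℝ (fun y => gaussVortexProfile y *
        (fderiv ℝ u y (EuclideanSpace.single 0 1) ^ 2 + fderiv ℝ u y (EuclideanSpace.single 1 1) ^ 2)) ξ w =
      fderiv ℝ gaussVortexProfile ξ w *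
          (fderiv ℝ u ξ (EuclideanSpace.single 0 1) ^ 2 + fderiv ℝ u ξ (EuclideanSpace.single 1 1) ^ 2) +
        gaussVortexProfile ξ *
          (2 * fderiv ℝ u ξ (EuclideanSpace.single 0 1) *
              fderiv ℝ (fderiv ℝ u) ξ w (EuclideanSpace.single 0 1) +
            2 * fderiv ℝ u ξ (EuclideanSpace.single 1 1) *
              fderiv ℝ (fderiv ℝ u) ξ w (EuclideanSpace.single 1 1)) := by
  have hGd : HasFDerivAt gaussVortexProfile (fderiv ℝ gaussVortexProfile ξ) ξ :=
    ((contDiff_gaussVortexProfile (n := 1)).differentiable one_ne_zero ξ).hasFDerivAt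
  have hdi : ∀ i : Fin 2, HasFDerivAt (fun y => fderiv ℝ u y (EuclideanSpace.single i 1))
      (fderiv ℝ (fun y => fderiv ℝ u y (EuclideanSpace.single i 1)) ξ) ξ := fun i =>
    ((contDiff_one_partialDeriv hu _).differentiable one_ne_zero ξ).hasFDerivAt
  have h0 : HasFDerivAt (fun y => fderiv ℝ u y (EuclideanSpace.single 0 1) ^ 2)
      ((2 * fderiv ℝ u ξ (EuclideanSpace.single 0 1)) •
        fderiv ℝ (fun y => fderiv ℝ u y (EuclideanSpace.single 0 1)) ξ) ξ := by
    simpa using (hdi 0).pow 2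
  have h1 : HasFDerivAt (fun y => fderiv ℝ u y (EuclideanSpace.single 1 1) ^ 2)
      ((2 * fderiv ℝ u ξ (EuclideanSpace.single 1 1)) •
        fderiv ℝ (fun y => fderiv ℝ u y (EuclideanSpace.single 1 1)) ξ) ξ := by
    simpa using (hdi 1).pow 2
  rw [(hGd.fun_mul (h0.fun_add h1)).fderiv]
  simp only [add_apply, FunLike.coe_smul, Pi.smul_apply, smul_eq_mul,
    fderiv_partialDeriv_apply hu]
  ring

/-- **`G ∇u·∇(∂_θu) = ½ ∂_θ(G|∇u|²)`**: with `v = ∂_θu = Du[ξ^⊥]`,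
`∂₀v · (G∂₀u) + ∂₁v · (G∂₁u) = ½ D(G ((∂₀u)² + (∂₁u)²))(ξ)[ξ^⊥]` — the commutator `[∇, ∂_θ]u = (∂₁u, −∂₀u)` is
orthogonal to `∇u`, `D²u` is symmetric, and `∂_θ G = 0`. [folklore] -/
theorem fderiv_angularDeriv_mul_gaussFlux_sum_eq (ξ : EuclideanSpace ℝ (Fin 2)) :
    fderiv ℝ (fun y => fderiv ℝ u y (perp y)) ξ (EuclideanSpace.single 0 1) *
          (gaussVortexProfile ξ * fderiv ℝ u ξ (EuclideanSpace.single 0 1)) +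
        fderiv ℝ (fun y => fderiv ℝ u y (perp y)) ξ (EuclideanSpace.single 1 1) *
          (gaussVortexProfile ξ * fderiv ℝ u ξ (EuclideanSpace.single 1 1)) =
      1 / 2 * fderiv ℝ (fun y => gaussVortexProfile y *
        (fderiv ℝ u y (EuclideanSpace.single 0 1) ^ 2 + fderiv ℝ u y (EuclideanSpace.single 1 1) ^ 2)) ξ (perp ξ) := by
  rw [fderiv_angularDeriv_apply hu, fderiv_angularDeriv_apply hu, perp_single_zero, perp_single_one, map_neg,
    fderiv_fderiv_symm_of_contDiff_two hu ξ (EuclideanSpace.single 0 1) (perp ξ),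
    fderiv_fderiv_symm_of_contDiff_two hu ξ (EuclideanSpace.single 1 1) (perp ξ), fderiv_gaussEnergy_apply hu,
    fderiv_gaussVortexProfile_apply, inner_self_perp]
  ring

/-! ### Bounds, for `u, Du, D²u` bounded by `M` -/

variable {M : ℝ} (hM : ∀ ξ, |u ξ| ≤ M ∧ ‖fderiv ℝ u ξ‖ ≤ M ∧ ‖fderiv ℝ (fderiv ℝ u) ξ‖ ≤ M)
include hM

omit hu in
/-- `|∂ᵢu| ≤ M`. [folklore] -/
theorem norm_partialDeriv_le_of_coreBound (ξ : EuclideanSpace ℝ (Fin 2)) (i : Fin 2) :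
    ‖fderiv ℝ u ξ (EuclideanSpace.single i 1)‖ ≤ M := by
  calc ‖fderiv ℝ u ξ (EuclideanSpace.single i 1)‖
      ≤ ‖fderiv ℝ u ξ‖ * ‖EuclideanSpace.single i (1 : ℝ)‖ := ContinuousLinearMap.le_opNorm _ _
    _ ≤ M * 1 := by
        gcongr
        · exact (norm_nonneg _).trans (hM ξ).2.1
        · exact (hM ξ).2.1
        · simp
    _ = M := mul_one M

omit hu in
/-- `|∂_θu(ξ)| ≤ M |ξ|`. [folklore] -/
theorem norm_angularDeriv_le_of_coreBound (ξ : EuclideanSpace ℝ (Fin 2)) : ‖fderiv ℝ u ξ (perp ξ)‖ ≤ M * ‖ξ‖ := by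
  calc ‖fderiv ℝ u ξ (perp ξ)‖ ≤ ‖fderiv ℝ u ξ‖ * ‖perp ξ‖ := ContinuousLinearMap.le_opNorm _ _
    _ ≤ M * ‖ξ‖ := by rw [norm_perp]; gcongr; exact (hM ξ).2.1

omit hu in
/-- `|D²u(ξ)[v][w]| ≤ M |v| |w|`. [folklore] -/
theorem norm_fderiv_fderiv_apply_le_of_coreBound (ξ v w : EuclideanSpace ℝ (Fin 2)) :
    ‖fderiv ℝ (fderiv ℝ u) ξ v w‖ ≤ M * ‖v‖ * ‖w‖ := by
  calc ‖fderiv ℝ (fderiv ℝ u) ξ v w‖ ≤ ‖fderiv ℝ (fderiv ℝ u) ξ v‖ * ‖w‖ := ContinuousLinearMap.le_opNorm _ _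
    _ ≤ ‖fderiv ℝ (fderiv ℝ u) ξ‖ * ‖v‖ * ‖w‖ := by gcongr; exact ContinuousLinearMap.le_opNorm _ _
    _ ≤ M * ‖v‖ * ‖w‖ := by gcongr; exact (hM ξ).2.2

/-- `|∂ᵢ(∂_θu)(ξ)| ≤ M (1 + |ξ|)`. [folklore] -/
theorem norm_fderiv_angularDeriv_single_le_of_coreBound (ξ : EuclideanSpace ℝ (Fin 2)) (i : Fin 2) :
    ‖fderiv ℝ (fun y => fderiv ℝ u y (perp y)) ξ (EuclideanSpace.single i 1)‖ ≤ M * (1 + ‖ξ‖) := by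
  rw [fderiv_angularDeriv_apply hu]
  have h1 : ‖fderiv ℝ u ξ (perp (EuclideanSpace.single i 1))‖ ≤ M * 1 := by
    calc ‖fderiv ℝ u ξ (perp (EuclideanSpace.single i 1))‖
        ≤ ‖fderiv ℝ u ξ‖ * ‖perp (EuclideanSpace.single i (1 : ℝ))‖ := ContinuousLinearMap.le_opNorm _ _
      _ ≤ M * 1 := by
          rw [norm_perp]
          gcongr
          · exact (norm_nonneg _).trans (hM ξ).2.1
          · exact (hM ξ).2.1
          · simp
  have h2 : ‖fderiv ℝ (fderiv ℝ u) ξ (EuclideanSpace.single i 1) (perp ξ)‖ ≤ M * 1 * ‖ξ‖ := by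
    have := norm_fderiv_fderiv_apply_le_of_coreBound hM ξ (EuclideanSpace.single i 1) (perp ξ)
    rw [norm_perp] at this
    simpa using this
  calc _ ≤ ‖fderiv ℝ u ξ (perp (EuclideanSpace.single i 1))‖ +
        ‖fderiv ℝ (fderiv ℝ u) ξ (EuclideanSpace.single i 1) (perp ξ)‖ := norm_add_le _ _
    _ ≤ M * 1 + M * 1 * ‖ξ‖ := add_le_add h1 h2
    _ = M * (1 + ‖ξ‖) := by ring

/-- `|∂ᵢ(G∂ᵢu)(ξ)| ≤ M (1 + |ξ|) G(ξ)`. [folklore] -/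
theorem norm_fderiv_gaussFlux_le_of_coreBound (ξ : EuclideanSpace ℝ (Fin 2)) (i : Fin 2) :
    ‖fderiv ℝ (fun y => gaussVortexProfile y * fderiv ℝ u y (EuclideanSpace.single i 1)) ξ
        (EuclideanSpace.single i 1)‖ ≤ M * ((1 + ‖ξ‖) * gaussVortexProfile ξ) := by
  rw [fderiv_gaussFlux_apply hu]
  have hG := gaussVortexProfile_pos ξ
  have hM0 : 0 ≤ M := (norm_nonneg _).trans (hM ξ).2.1
  have hxi := abs_coord_le_norm_fin_two ξ i
  have hd := norm_partialDeriv_le_of_coreBound hM ξ i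
  have hdd : ‖fderiv ℝ (fderiv ℝ u) ξ (EuclideanSpace.single i 1) (EuclideanSpace.single i 1)‖ ≤ M := by
    simpa using norm_fderiv_fderiv_apply_le_of_coreBound hM ξ (EuclideanSpace.single i 1) (EuclideanSpace.single i 1)
  rw [Real.norm_eq_abs] at hd hdd
  calc _ ≤ ‖-(gaussVortexProfile ξ / 2) * ξ i * fderiv ℝ u ξ (EuclideanSpace.single i 1)‖ +
        ‖gaussVortexProfile ξ *
          fderiv ℝ (fderiv ℝ u) ξ (EuclideanSpace.single i 1) (EuclideanSpace.single i 1)‖ := norm_add_le _ _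
    _ = gaussVortexProfile ξ / 2 * |ξ i| * |fderiv ℝ u ξ (EuclideanSpace.single i 1)| +
        gaussVortexProfile ξ *
          |fderiv ℝ (fderiv ℝ u) ξ (EuclideanSpace.single i 1) (EuclideanSpace.single i 1)| := by
        rw [Real.norm_eq_abs, Real.norm_eq_abs, abs_mul, abs_mul, abs_mul, abs_neg,
          abs_of_pos (half_pos hG), abs_of_pos hG]
    _ ≤ gaussVortexProfile ξ / 2 * ‖ξ‖ * M + gaussVortexProfile ξ * M := by gcongr
    _ ≤ M * ((1 + ‖ξ‖) * gaussVortexProfile ξ) := by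
        nlinarith [mul_nonneg (mul_nonneg hM0 (norm_nonneg ξ)) hG.le]

end AngularCalculus

/-! ### The registered helper: divergence form of `G·A` -/

/-- **Divergence form of the ground-state conjugated core operator** `G (Δu − ½ ξ·∇u) = ∂₀(G ∂₀u) + ∂₁(G ∂₁u)` for
`u ∈ C²(ℝ²)`: `L(Gu) = ∇·(G∇u)` (Gallay–Wayne 2005, (73); `∇G = −(ξ/2)G`). [folklore] -/
theorem coreL_gauss_divergence_form :
    ∀ u : EuclideanSpace ℝ (Fin 2) → ℝ, ContDiff ℝ 2 u → ∀ ξ : EuclideanSpace ℝ (Fin 2),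
      gaussVortexProfile ξ * (Δ u ξ - (1 / 2 * ξ 0 * fderiv ℝ u ξ (EuclideanSpace.single 0 1) +
          1 / 2 * ξ 1 * fderiv ℝ u ξ (EuclideanSpace.single 1 1))) =
        fderiv ℝ (fun y => gaussVortexProfile y * fderiv ℝ u y (EuclideanSpace.single 0 1)) ξ
            (EuclideanSpace.single 0 1) +
          fderiv ℝ (fun y => gaussVortexProfile y * fderiv ℝ u y (EuclideanSpace.single 1 1)) ξ
            (EuclideanSpace.single 1 1) :=
  fun _ hu ξ => gauss_mul_ornsteinUhlenbeck_eq_sum_fderiv_gaussFlux hu ξ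

end Summit.AnomalousDissipation.AnomalousDissipation.Theorems.MarginalStabilityChainStretchedVortexRows

end
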